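import Mathlib
import Summits.NavierStokesRegularity.NavierStokesRegularity.Theorems.EulerZoomLiouvillePowerGaugeEulerLiouvilleSelfSimilarThinSetsC2b
import Summits.NavierStokesRegularity.NavierStokesRegularity.Theorems.EulerZoomLiouvillePowerGaugeEulerLiouvilleSelfSimilarBadSetThin
import HarnessLib.Audit

/-!
# Rung C1 of the crux `EulerZoomLiouville.PowerGaugeEulerLiouville` (W1 stage S4c): EVERY VORTICAL and EVERY BAD stagnation point is
# THIN — FOR `C²` PROFILES

Route №10 `EulerZoomLiouville` (NavierStokesRegularity), crux E = stmt-NavierStokesRegularity-19832, tenure rung C1,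
registered residue `stub_selfSimilarExtremalRest`, sub-stratum W1 («`C²` but not `C^∞` profiles»).  Lineage ns-typeII-p2 (gen 8,
INTERIM LEAD).  `C²` twins (namespace `…PowerGaugeEulerLiouville.C2.Kelvin`, same short names as ns-typeII-p3's `…Kelvin`
originals, proofs verbatim) on the `C²` flow API `…SelfSimilarKelvinFlowC2` (S1: joint `C²` flow, `C²` variational equation).
WHAT THIS IS NOT: not NS, not E, not rung C1 — thin-basin lemmas for `C²` profiles with bounded gradient.
[folklore; ConstantinIgnatovaVicol2026Putative §3.5 (setting); Robinson 1999 Ch. V (cone/trapped-set arguments, tree form)]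
-/

noncomputable section

-- flat `Theorems/<Route><Decl>…` files of one crux share the namespace of the crux (tree convention)
set_option linter.dupNamespace false

open MeasureTheory Set Filter Topology Metric Function InnerProductSpace
open scoped RealInnerProductSpace NNReal ContDiff Nat

namespace Summit.NavierStokesRegularity.NavierStokesRegularity.Theorems.PowerGaugeEulerLiouville.C2.Kelvin

open Literature.Analysis Literature.Analysis.FluidPDE Literature.Dynamics.FixedPoints
  Literature.Dynamics.TopologicalDynamics
open Summit.NavierStokesRegularity.NavierStokesRegularity.Theorems.PowerGaugeEulerLiouville.Kelvin

variable {γ : ℝ} {V : EuclideanSpace ℝ (Fin 3) → EuclideanSpace ℝ (Fin 3)} {P : EuclideanSpace ℝ (Fin 3) → ℝ}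

/-- **EVERY VORTICAL STAGNATION POINT IS THIN.**  Let `(V, P)` be a classical self-similar Euler profile with `V`
smooth, `‖DV‖ ≤ K`, `−1 < γ < ½`, and let `z ∈ 𝒩_W` be a stagnation point of `W = γy + V` with `Ω(z) = curl V(z) ≠ 0`.
Then for some sampling time `T > 0` and radius `r > 0` the set of points admitting a `Φ_T`-past history inside
`B(z, r)` is Lebesgue-null — with NO hypothesis on the linearisation.  Proof: `A = DW(z) = γI + DV(z)` has
`AΩ(z) = (1+γ)Ω(z)` (CIV (3.24) frozen at the node) and `tr A = 3γ`, so `χ_A = (X − (1+γ))(X² + uX + w)` with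
`u = 1 − 2γ > 0`; the four spectral cases (complex pair / three distinct reals / `r₂ = 1+γ` / double root, the last
two possibly defective) are the four thin shapes `…_of_contractingPlane`, `…_of_dominatedBlock`,
`…_of_eigenline_lt_doubleRoot`, `…_of_doubleRoot_lt_eigenline`.
[cite: ConstantinIgnatovaVicol2026Putative, §3.4.1 eq. (3.22)/(3.24) (vorticity eigen-relation at a node); Robinson1999, Ch. V §5.10.1 (cone estimate, dominated form; proved in the tree)] -/
theorem exists_trappedSet_null_of_curl_ne_zero (hV : ContDiff ℝ 2 V) {K : ℝ} (hK : ∀ y, ‖fderiv ℝ V y‖ ≤ K)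
    (hprof : IsSelfSimilarEulerProfile γ 0 V P) (hγ1 : -1 < γ) (hγ2 : γ < 1 / 2)
    {z : EuclideanSpace ℝ (Fin 3)} (hz : z ∈ selfSimilarNodalSet γ 0 V) (hcurl : curl V z ≠ 0) :
    ∃ T : ℝ, 0 < T ∧ ∃ r : ℝ, 0 < r ∧ volume {q : EuclideanSpace ℝ (Fin 3) | ∃ qs : ℕ → EuclideanSpace ℝ (Fin 3),
      qs 0 = q ∧ (∀ k, ODE.evolutionMap (fun _ : ℝ => selfSimilarTransport γ 0 V) 0 T (qs (k + 1)) = qs k) ∧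
        ∀ k, qs k ∈ ball z r} = 0 := by
  set A : EuclideanSpace ℝ (Fin 3) →L[ℝ] EuclideanSpace ℝ (Fin 3) :=
    γ • ContinuousLinearMap.id ℝ (EuclideanSpace ℝ (Fin 3)) + fderiv ℝ V z with hA
  -- the eigen-relation `AΩ = (1+γ)Ω` and the trace
  have hAom : A (curl V z) = (1 + γ) • curl V z := by
    have h := hprof.isSelfSimilarEulerVorticityProfile.fderiv_apply_curl_eq_of_mem_nodalSet hz
    rw [show A (curl V z) = γ • curl V z + fderiv ℝ V z (curl V z) from rfl, h]
    module
  have htr : LinearMap.trace ℝ _ (A : EuclideanSpace ℝ (Fin 3) →ₗ[ℝ] EuclideanSpace ℝ (Fin 3)) = 3 * γ := by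
    have hd : LinearMap.trace ℝ _ (fderiv ℝ V z : EuclideanSpace ℝ (Fin 3) →ₗ[ℝ] EuclideanSpace ℝ (Fin 3)) = 0 :=
      hprof.divFree z
    rw [hA, ContinuousLinearMap.toLinearMap_add, ContinuousLinearMap.toLinearMap_smul, map_add, map_smul, hd,
      add_zero, ContinuousLinearMap.coe_id, LinearMap.trace_id, finrank_euclideanSpace, Fintype.card_fin, smul_eq_mul]
    push_cast
    ring
  obtain ⟨u, w, hu, hQ, hroots⟩ := exists_quadraticCofactor A hcurl hAom
  have hu' : u = 1 - 2 * γ := by rw [hu, htr]; ring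
  have hu0 : 0 < u := by rw [hu']; linarith
  have hlam : 0 < 1 + γ := by linarith
  -- `A` is not the scalar `1+γ`
  have hne : ∃ x : EuclideanSpace ℝ (Fin 3), A x ≠ (1 + γ) • x := by
    by_contra h
    push Not at h
    have hAeq : (A : EuclideanSpace ℝ (Fin 3) →ₗ[ℝ] EuclideanSpace ℝ (Fin 3)) = (1 + γ) • LinearMap.id := by
      apply LinearMap.ext; intro x; exact h x
    have htr' := htr
    rw [hAeq, map_smul, LinearMap.trace_id, finrank_euclideanSpace, Fintype.card_fin, smul_eq_mul] at htr'
    push_cast at htr'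
    linarith
  -- `ker(A² + uA + w) ≠ 0`
  have hb₀ : ∃ b₀ : EuclideanSpace ℝ (Fin 3), b₀ ≠ 0 ∧ A (A b₀) + u • A b₀ + w • b₀ = 0 := by
    by_contra h
    push Not at h
    set Q : EuclideanSpace ℝ (Fin 3) →ₗ[ℝ] EuclideanSpace ℝ (Fin 3) :=
      ((A * A + u • A + w • 1 : EuclideanSpace ℝ (Fin 3) →L[ℝ] EuclideanSpace ℝ (Fin 3)) :
        EuclideanSpace ℝ (Fin 3) →ₗ[ℝ] EuclideanSpace ℝ (Fin 3)) with hQdef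
    have hQapp : ∀ x, Q x = A (A x) + u • A x + w • x := fun x => rfl
    have hinj : Function.Injective Q := by
      rw [← LinearMap.ker_eq_bot, Submodule.eq_bot_iff]
      intro x hx
      rw [LinearMap.mem_ker, hQapp] at hx
      by_contra hx0
      exact h x hx0 hx
    obtain ⟨x, hx⟩ := hne
    obtain ⟨y, rfl⟩ := (LinearMap.injective_iff_surjective.1 hinj) x
    exact hx (by rw [hQapp]; exact hQ y)
  rcases lt_or_ge (u ^ 2) (4 * w) with hdisc | hdisc
  · -- complex pair: contracting plane dominated by the vortical eigenline
    obtain ⟨b₀, hb₀ne, hQb₀⟩ := hb₀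
    obtain ⟨b, δ, hδ, hA0, hA1, hA2⟩ := exists_blockBasis_of_complexPair A hcurl hAom hdisc hb₀ne hQb₀
    refine exists_trappedSet_null_of_contractingPlane hV hK hz b ![-(u / 2), -(u / 2), 1 + γ] δ
      (by exact hA0) (by exact hA1) (by exact hA2) ?_ ?_ ?_ ?_
    · change -(u / 2) < 0; linarith
    · change -(u / 2) < 0; linarith
    · change -(u / 2) < 1 + γ; linarith
    · change -(u / 2) < 1 + γ; linarith
  · -- real roots `r₁ ≤ r₂` of the quadratic factor
    set D : ℝ := u ^ 2 - 4 * w with hD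
    have hD0 : 0 ≤ D := by rw [hD]; linarith
    set r₁ : ℝ := (-u - Real.sqrt D) / 2 with hr₁
    set r₂ : ℝ := (-u + Real.sqrt D) / 2 with hr₂
    have hsD := Real.sq_sqrt hD0
    have hsD0 := Real.sqrt_nonneg D
    have hsum : r₁ + r₂ = -u := by rw [hr₁, hr₂]; ring
    have hprod : r₁ * r₂ = w := by
      rw [hr₁, hr₂]
      nlinarith [hsD]
    have hr₁0 : r₁ < 0 := by rw [hr₁]; nlinarith
    have hr₁1 : r₁ < 1 + γ := by linarith
    have hroot₁ : r₁ ^ 2 + u * r₁ + w = 0 := by linear_combination r₁ * hsum - hprod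
    have hroot₂ : r₂ ^ 2 + u * r₂ + w = 0 := by linear_combination r₂ * hsum - hprod
    obtain ⟨v₁, hv₁, hAv₁⟩ := hroots r₁ hroot₁
    by_cases h2 : r₂ = 1 + γ
    · -- `χ_A = (X − r₁)(X − (1+γ))²`: eigenline below a (possibly defective) double root
      refine exists_trappedSet_null_of_eigenline_lt_doubleRoot hV hK hz hv₁ hAv₁ hr₁0 hr₁1 (fun x => ?_)
      have hux : u = -(r₁ + (1 + γ)) := by rw [← h2]; linarith
      have hwx : w = r₁ * (1 + γ) := by rw [← h2, hprod]
      have h := hQ x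
      rw [hux, hwx] at h
      change A (A (A x - (1 + γ) • x) - (1 + γ) • (A x - (1 + γ) • x)) =
        r₁ • (A (A x - (1 + γ) • x) - (1 + γ) • (A x - (1 + γ) • x))
      rw [← sub_eq_zero]
      have h' : A (A (A x) + -(r₁ + (1 + γ)) • A x + (r₁ * (1 + γ)) • x) -
          (1 + γ) • (A (A x) + -(r₁ + (1 + γ)) • A x + (r₁ * (1 + γ)) • x) = 0 := sub_eq_zero.2 h
      rw [← h']
      simp only [map_add, map_sub, map_smul]
      module
    · by_cases h12 : D = 0
      · -- `χ_A = (X − (1+γ))(X − r₁)²`: a (possibly defective) double root below the vortical eigenline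
        have hr12 : r₂ = r₁ := by rw [hr₁, hr₂, h12, Real.sqrt_zero]; ring
        refine exists_trappedSet_null_of_doubleRoot_lt_eigenline hV hK hz hr₁0 hr₁1 hne (fun x => ?_)
        have hux : u = -(2 * r₁) := by rw [hr12] at hsum; linarith
        have hwx : w = r₁ * r₁ := by rw [← hprod, hr12]
        have h := hQ x
        rw [hux, hwx] at h
        change A (A (A x - r₁ • x) - r₁ • (A x - r₁ • x)) = (1 + γ) • (A (A x - r₁ • x) - r₁ • (A x - r₁ • x))
        rw [← sub_eq_zero]
        have h' : A (A (A x) + -(2 * r₁) • A x + (r₁ * r₁) • x) -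
            (1 + γ) • (A (A x) + -(2 * r₁) • A x + (r₁ * r₁) • x) = 0 := sub_eq_zero.2 h
        rw [← h']
        simp only [map_add, map_sub, map_smul]
        module
      · -- three distinct real eigenvalues `r₁ < r₂`, `1 + γ`: an eigenbasis, contracting line
        have hDpos : 0 < D := lt_of_le_of_ne hD0 (Ne.symm h12)
        have hsDpos : 0 < Real.sqrt D := Real.sqrt_pos.2 hDpos
        have hr12 : r₁ < r₂ := by rw [hr₁, hr₂]; linarith
        obtain ⟨v₂, hv₂, hAv₂⟩ := hroots r₂ hroot₂
        have hinj : Function.Injective ![r₂, 1 + γ, r₁] := by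
          intro i j hij
          fin_cases i <;> fin_cases j <;> simp at hij ⊢ <;> first | linarith | exact h2 hij | exact h2 hij.symm
        have hli : LinearIndependent ℝ ![v₂, curl V z, v₁] := by
          refine Module.End.eigenvectors_linearIndependent'
            (A : EuclideanSpace ℝ (Fin 3) →ₗ[ℝ] EuclideanSpace ℝ (Fin 3)) ![r₂, 1 + γ, r₁] hinj _ (fun i => ?_)
          fin_cases i
          · exact ⟨Module.End.mem_eigenspace_iff.2 (by exact hAv₂), hv₂⟩
          · exact ⟨Module.End.mem_eigenspace_iff.2 (by exact hAom), hcurl⟩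
          · exact ⟨Module.End.mem_eigenspace_iff.2 (by exact hAv₁), hv₁⟩
        have hcard : Fintype.card (Fin 3) = Module.finrank ℝ (EuclideanSpace ℝ (Fin 3)) := by
          rw [Fintype.card_fin, finrank_euclideanSpace_fin]
        set b := basisOfLinearIndependentOfCardEqFinrank hli hcard with hbdef
        have hb : ⇑b = ![v₂, curl V z, v₁] := coe_basisOfLinearIndependentOfCardEqFinrank hli hcard
        have hb0 : b 0 = v₂ := by rw [hb]; rfl
        have hb1 : b 1 = curl V z := by rw [hb]; rfl
        have hb2 : b 2 = v₁ := by rw [hb]; rfl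
        refine exists_trappedSet_null_of_dominatedBlock hV hK hz b ![r₂, 1 + γ, r₁] 0 ?_ ?_ ?_ ?_ ?_ ?_
        · rw [hb0, hb1, zero_smul, sub_zero]; exact hAv₂
        · rw [hb0, hb1, zero_smul, zero_add]; exact hAom
        · rw [hb2]; exact hAv₁
        · exact hr₁0
        · exact hr12
        · exact hr₁1

/-- **Every bad stagnation point is thin.**  `(V, P)` classical, `V` smooth, `‖DV‖ ≤ K`, `0 < γ < ½`, `z ∈ 𝒩_W` with
`1 ≤ ⟪DV(z)w, w⟫` for a unit `w` ⇒ a null `Φ_T`-trapped set near `z` (non-vortical: symmetric thin block form,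
`exists_thinBlock_of_curl_eq_zero_of_bad`; vortical: `exists_trappedSet_null_of_curl_ne_zero`).
[cite: Robinson1999, Ch. V §5.10.1 (cone estimate, dominated form; proved in the tree)] -/
theorem exists_trappedSet_null_of_bad (hV : ContDiff ℝ 2 V) {K : ℝ} (hK : ∀ y, ‖fderiv ℝ V y‖ ≤ K)
    (hprof : IsSelfSimilarEulerProfile γ 0 V P) (hγ : 0 < γ) (hγ2 : γ < 1 / 2)
    {z : EuclideanSpace ℝ (Fin 3)} (hz : z ∈ selfSimilarNodalSet γ 0 V)
    (hbad : ∃ w : EuclideanSpace ℝ (Fin 3), ‖w‖ = 1 ∧ 1 ≤ ⟪fderiv ℝ V z w, w⟫) :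
    ∃ T : ℝ, 0 < T ∧ ∃ r : ℝ, 0 < r ∧ volume {q : EuclideanSpace ℝ (Fin 3) | ∃ qs : ℕ → EuclideanSpace ℝ (Fin 3),
      qs 0 = q ∧ (∀ k, ODE.evolutionMap (fun _ : ℝ => selfSimilarTransport γ 0 V) 0 T (qs (k + 1)) = qs k) ∧
        ∀ k, qs k ∈ ball z r} = 0 := by
  by_cases hcurl : curl V z = 0
  · obtain ⟨b, lam, β, hA0, hA1, hA2, hshape⟩ :=
      exists_thinBlock_of_curl_eq_zero_of_bad (hV.differentiable (by simp)) hprof.divFree hγ2 hcurl hbad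
    rcases hshape with ⟨h2, h20, h21⟩ | ⟨h0, h1, h02, h12⟩
    · exact exists_trappedSet_null_of_dominatedBlock hV hK hz b lam β hA0 hA1 hA2 h2 h20 h21
    · exact exists_trappedSet_null_of_contractingPlane hV hK hz b lam β hA0 hA1 hA2 h0 h1 h02 h12
  · exact exists_trappedSet_null_of_curl_ne_zero hV hK hprof (by linarith) hγ2 hz hcurl

end Summit.NavierStokesRegularity.NavierStokesRegularity.Theorems.PowerGaugeEulerLiouville.C2.Kelvin

end
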